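import Mathlib
import HarnessLib
import Summits.Langlands.Langlands.Theorems.SkinnerWilesDefectOneEisensteinProModularSeedLevelRaisedEisensteinNewformQ
import Summits.Langlands.Langlands.Theorems.SkinnerWilesDefectOneEisensteinProModularSeedInertBMPrimeSupply

/-!
# `EisensteinProModularSeed` (stmt-Langlands-12920), line `descend-raise-basechange` (v3), stub S2'
# `stub_eisensteinPackageQ` — support file I: the Billerey–Menares weight, the level-raising prime

Support file (`--supports stmt-Langlands-12920`) for the `ℚ`-side package of the WIDENED line (all
odd `η̄`, Billerey–Menares 2016).  Everything here is PROVED (no named fact, no definition):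

* `exists_bmWeight` — for `p` odd and a continuous unit-valued `η : Γ_ℚ → ℚ̄_pˣ` there is a
  Billerey–Menares weight `k ∈ {p, p + 1} ∪ [3, p - 1]` with `η̄ = ω^{k-1}` on the inertia group of a
  prime `𝔓 ∣ p` (local Kronecker–Weber, as the landed `exists_weight_of_window` minus the window);
  registered sub-goal alias `stub_eisensteinPackageQ_auxWeight`;
* `natCast_pow_sub_one_mod_sq`, `v_natCast_add_one_lt_one` — the arithmetic of a level-raising prime
  `M ≡ -1 (mod p²)`: `M^{p-1} ≡ 1 (mod p²)`, `v (M + 1) < 1`; small valuation lemmas on `ℚ̄_p`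
  (`v_natCast_eq_one_of_not_dvd`, `v_natCast_prime_lt_one`, `v_zpow_sub_one_lt_one`, the unit root, odd `det`).

References: N. Billerey, R. Menares, Math. Res. Lett. 23 (2016), §2 (the weight `k`);
J.-P. Serre, Invent. Math. 15 (1972), §1, Prop. 3. [folklore]
-/

set_option linter.dupNamespace false -- project-wide option (lakefile weak.linter.dupNamespace); `Summit.Langlands.Langlands` is the mandated namespace

noncomputable section

namespace Summit.Langlands.Langlands.Theorems.SkinnerWilesDefectOne.EisensteinProModularSeed

open Literature.NumberTheory.GaloisRepresentations
open NumberField IsDedekindDomain IsLocalRing Field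
open scoped MatrixGroups Matrix

/-! ### The Billerey–Menares weight of `1 ⊕ η̄` -/

section Weight

open scoped Valued

/-- **The Billerey–Menares weight.**  For `p` odd and a continuous unit-valued `η : Γ_ℚ → ℚ̄_pˣ`,
write `η̄|_{I_p} = ω^b` with `0 ≤ b ≤ p - 2` (a character of the tame inertia that extends to the
decomposition group is a power of the fundamental character of level one — Serre 1972, §1, Prop. 3 —,
here from the tree's local Kronecker–Weber theorem in inertia form, exactly as in the landed
`exists_weight_of_window`); then with `k := p` (`b = 0`), `p + 1` (`b = 1`), `b + 1` (`b ≥ 2`) — the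
weight of Billerey–Menares 2016, §2 — one has `k - 1 ≡ b (mod p - 1)`, hence `η̄ = ω^{k-1}` on the
inertia group of the prime `𝔓₀ ∣ p` of the chosen embedding (`ω^{p-1} = 1`). [folklore] -/
theorem exists_bmWeight :
    ∀ (p : ℕ) [Fact p.Prime], p ≠ 2 → ∀ (η : Field.absoluteGaloisGroup ℚ →ₜ* (PadicAlgCl p)ˣ),
      (∀ τ, Valued.v ((η τ : (PadicAlgCl p)ˣ) : PadicAlgCl p) = 1) →
      ∀ (w : IsDedekindDomain.HeightOneSpectrum (NumberField.RingOfIntegers ℚ)),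
      (p : NumberField.RingOfIntegers ℚ) ∈ w.asIdeal →
      ∃ k : ℕ, (k = p ∨ k = p + 1 ∨ (3 ≤ k ∧ k + 1 ≤ p)) ∧
        ∃ 𝔓 ∈ w.primesAbove, ∀ σ ∈ 𝔓.inertia (Field.absoluteGaloisGroup ℚ),
        Valued.v (((η σ : (PadicAlgCl p)ˣ) : PadicAlgCl p) -
          algebraMap (Padic p) (PadicAlgCl p)
            (((Literature.NumberTheory.GaloisRepresentations.GaloisRep.cyclotomicCharacter ℚ p σ).val :
              PadicInt p) : Padic p) ^ (k - 1)) < 1 := by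
  -- adapted from the landed `exists_weight_of_window` (same file family, …Inertia): the window is dropped
  intro p hp hp2 η hunit w hpw
  classical
  haveI : NeZero p := ⟨hp.out.ne_zero⟩
  have hwp : ((Rat.HeightOneSpectrum.primesEquiv w : Nat.Primes) : ℕ) = p :=
    (natCast_mem_asIdeal_iff_primesEquiv w hp.out).mp hpw
  obtain ⟨𝔓, h𝔓w, hlift, -⟩ := exists_primesAbove_inertia_eq_absGaloisRestrict w
  set A : ValuationSubring (PadicAlgCl p) := (Valued.v : Valuation (PadicAlgCl p) NNReal).valuationSubring
    with hA
  haveI : CharP (ResidueField A) p := charP_residueField p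
  have hηU : ∀ τ, (η τ : (PadicAlgCl p)ˣ) ∈ A.unitGroup := fun τ =>
    (Valuation.mem_unitGroup_iff (v := (Valued.v : Valuation (PadicAlgCl p) NNReal))
      (x := (η τ : (PadicAlgCl p)ˣ))).mpr (hunit τ)
  set ηU : absoluteGaloisGroup ℚ →* A.unitGroup := η.toMonoidHom.codRestrict A.unitGroup hηU with hηU_def
  set Λ₀ : absoluteGaloisGroup ℚ →* (ResidueField A)ˣ := A.unitGroupToResidueFieldUnits.comp ηU
    with hΛ₀
  set Λ : absoluteGaloisGroup (w.adicCompletion ℚ) →* (ResidueField A)ˣ :=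
    Λ₀.comp (absGaloisRestrict ℚ (w.adicCompletion ℚ)).toMonoidHom with hΛ
  have hker₀ : ∀ τ, Λ₀ τ = 1 ↔ Valued.v (((η τ : (PadicAlgCl p)ˣ) : PadicAlgCl p) - 1) < 1 := by
    intro τ
    change A.unitGroupToResidueFieldUnits (ηU τ) = 1 ↔ _
    rw [← MonoidHom.mem_ker, ValuationSubring.ker_unitGroupToResidueFieldUnits, Subgroup.mem_comap,
      Subgroup.coe_subtype, ValuationSubring.mem_principalUnitGroup_iff]
    change A.valuation (((η τ : (PadicAlgCl p)ˣ) : PadicAlgCl p) - 1) < 1 ↔ _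
    exact ((Valuation.isEquiv_valuation_valuationSubring _).lt_one_iff_lt_one).symm
  have hcoeη : ∀ τ, ((A.unitGroupMulEquiv (ηU τ) : A) : PadicAlgCl p) =
      ((η τ : (PadicAlgCl p)ˣ) : PadicAlgCl p) := fun τ => rfl
  have hopen : IsOpen ((Λ.ker : Subgroup (absoluteGaloisGroup (w.adicCompletion ℚ))) :
      Set (absoluteGaloisGroup (w.adicCompletion ℚ))) := by
    have hset : ((Λ.ker : Subgroup (absoluteGaloisGroup (w.adicCompletion ℚ))) :
        Set (absoluteGaloisGroup (w.adicCompletion ℚ))) =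
        (fun σ => ((η (absGaloisRestrict ℚ (w.adicCompletion ℚ) σ) : (PadicAlgCl p)ˣ) :
          PadicAlgCl p) - 1) ⁻¹' Metric.ball 0 1 := by
      ext σ
      rw [SetLike.mem_coe, MonoidHom.mem_ker, Set.mem_preimage, mem_ball_zero_iff,
        ← v_lt_one_iff_norm_lt_one']
      exact hker₀ _
    rw [hset]
    refine Metric.isOpen_ball.preimage ?_
    exact (Units.continuous_val.comp (η.continuous.comp
      (absGaloisRestrict ℚ (w.adicCompletion ℚ)).continuous)).sub continuous_const
  have hcomm : ∀ a b, Λ a * Λ b = Λ b * Λ a := fun a b => mul_comm _ _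
  obtain ⟨m, hm, g, hg⟩ :=
    adicCompletion_rat_exists_eq_comp_cyclotomicCharacter_of_mem_absInertia p w hwp Λ hopen hcomm
  obtain ⟨j, hj, hgj⟩ := monoidHom_units_zmod_primePow_eq_pow hp2 hm g
  obtain ⟨ψ, hψ⟩ := exists_ringHom_padicInt_valuationSubring p
  set φ₁ : ℤ_[p] →+* ResidueField A := (residue A).comp ψ with hφ₁
  set φ₂ : ℤ_[p] →+* ResidueField A :=
    (ZMod.castHom (dvd_refl p) (ResidueField A)).comp
      ((ZMod.castHom (dvd_pow_self p hm.ne') (ZMod p)).comp (PadicInt.toZModPow m)) with hφ₂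
  have hφ : ∀ x, φ₂ x = φ₁ x := fun x => by
    rw [ringHom_padicInt_apply φ₁, ringHom_padicInt_apply φ₂]
  -- the key congruence on the local inertia group, transported to `I_{𝔓₀}`
  have hkey : ∀ σ ∈ absInertia (w.adicCompletion ℚ),
      Valued.v (((η (absGaloisRestrict ℚ (w.adicCompletion ℚ) σ) : (PadicAlgCl p)ˣ) : PadicAlgCl p) -
        algebraMap ℚ_[p] (PadicAlgCl p)
          (((GaloisRep.cyclotomicCharacter (w.adicCompletion ℚ) p σ).val : ℤ_[p]) : ℚ_[p]) ^ j) < 1 := by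
    intro σ hσ
    set u := GaloisRep.cyclotomicCharacter (w.adicCompletion ℚ) p σ with hu
    have h1 : ((Λ σ : (ResidueField A)ˣ) : ResidueField A) = (φ₂ (u : ℤ_[p])) ^ j := by
      rw [hg σ hσ, hgj]
      congr 1
    have h2 : ((Λ σ : (ResidueField A)ˣ) : ResidueField A) =
        residue A (A.unitGroupMulEquiv (ηU (absGaloisRestrict ℚ (w.adicCompletion ℚ) σ)) : A) := rfl
    rw [h2, hφ, hφ₁, RingHom.comp_apply, ← map_pow, ← sub_eq_zero, ← map_sub,
      residue_eq_zero_iff, Valuation.mem_maximalIdeal_iff] at h1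
    convert h1 using 2
    push_cast
    rw [hcoeη, hψ]
  haveI : NeZero ((p : ℕ) : ℚ) := NeZero.charZero
  have hkey' : ∀ τ ∈ 𝔓.inertia (absoluteGaloisGroup ℚ),
      Valued.v (((η τ : (PadicAlgCl p)ˣ) : PadicAlgCl p) -
        algebraMap ℚ_[p] (PadicAlgCl p)
          (((GaloisRep.cyclotomicCharacter ℚ p τ).val : ℤ_[p]) : ℚ_[p]) ^ j) < 1 := by
    intro τ hτ
    obtain ⟨σ, hσ, rfl⟩ := hlift τ hτ
    rw [cyclotomicCharacter_absGaloisRestrict]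
    exact hkey σ hσ
  -- `χ_p^(p-1) ≡ 1` on `Γ_ℚ`, and `v χ_p ≤ 1`
  have hFermat : ∀ τ : absoluteGaloisGroup ℚ,
      Valued.v (algebraMap ℚ_[p] (PadicAlgCl p)
          (((GaloisRep.cyclotomicCharacter ℚ p τ).val : ℤ_[p]) : ℚ_[p]) ^ (p - 1) - 1) < 1 := by
    intro τ
    set u := GaloisRep.cyclotomicCharacter ℚ p τ with hu
    set φ₃ : ℤ_[p] →+* ResidueField A :=
      (ZMod.castHom (dvd_refl p) (ResidueField A)).comp PadicInt.toZMod with hφ₃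
    have hφ₃₁ : ∀ x, φ₃ x = φ₁ x := fun x => by
      rw [ringHom_padicInt_apply φ₁, ringHom_padicInt_apply φ₃]
    have hne : PadicInt.toZMod (u : ℤ_[p]) ≠ 0 :=
      (Units.map (PadicInt.toZMod (p := p)).toMonoidHom u).ne_zero
    have h1 : (φ₁ (u : ℤ_[p])) ^ (p - 1) = 1 := by
      rw [← hφ₃₁, hφ₃, RingHom.comp_apply, ← map_pow, ZMod.pow_card_sub_one_eq_one hne, map_one]
    rw [hφ₁, RingHom.comp_apply, ← map_pow, ← (residue A).map_one, ← sub_eq_zero, ← map_sub,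
      residue_eq_zero_iff, Valuation.mem_maximalIdeal_iff] at h1
    convert h1 using 2
    push_cast
    rw [hψ]
  have hcle : ∀ τ : absoluteGaloisGroup ℚ, Valued.v (algebraMap ℚ_[p] (PadicAlgCl p)
      (((GaloisRep.cyclotomicCharacter ℚ p τ).val : ℤ_[p]) : ℚ_[p])) ≤ 1 := fun τ => by
    rw [← hψ]
    exact (Valuation.mem_valuationSubring_iff _ _).mp (SetLike.coe_mem _)
  -- the three cases of the Billerey–Menares weight
  rcases Nat.lt_or_ge j 2 with hj2 | hj2
  · interval_cases j
    · -- `b = 0`: `k = p`, `ω^(p-1) ≡ 1 ≡ η̄`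
      refine ⟨p, Or.inl rfl, 𝔓, h𝔓w, fun σ hσ => ?_⟩
      have h1 := hkey' σ hσ
      rw [pow_zero] at h1
      have h2 := v_sub_lt_one h1 (hFermat σ)
      convert h2 using 2
      ring
    · -- `b = 1`: `k = p + 1`, `ω^p ≡ ω ≡ η̄`
      refine ⟨p + 1, Or.inr (Or.inl rfl), 𝔓, h𝔓w, fun σ hσ => ?_⟩
      have h1 := hkey' σ hσ
      rw [pow_one] at h1
      have h2 := v_sub_lt_one h1 (v_mul_lt_one_right (hcle σ) (hFermat σ))
      convert h2 using 2
      have hp1 : p + 1 - 1 = (p - 1) + 1 := by have := hp.out.two_le; omega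
      rw [hp1, pow_succ]
      ring
  · -- `b ≥ 2`: `k = b + 1`
    refine ⟨j + 1, Or.inr (Or.inr ⟨by omega, by omega⟩), 𝔓, h𝔓w, fun σ hσ => ?_⟩
    rw [Nat.add_sub_cancel]
    exact hkey' σ hσ

end Weight

/-! ### Arithmetic of the level-raising prime `M ≡ -1 (mod p²)` -/

section LevelRaisingPrime

variable {p : ℕ} [hp : Fact p.Prime]

/-- `M ≡ -1 (mod p²)` and `p` odd give `M^{p-1} ≡ 1 (mod p²)`. [folklore] -/
theorem natCast_pow_sub_one_mod_sq (hp2 : p ≠ 2) {M : ℕ} (hM : M % (p ^ 2) = p ^ 2 - 1) :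
    M ^ (p - 1) % p ^ 2 = 1 := by
  have hp1 : 1 < p ^ 2 := Nat.one_lt_pow two_ne_zero hp.out.one_lt
  haveI : Fact (1 < p ^ 2) := ⟨hp1⟩
  have hMz : (M : ZMod (p ^ 2)) = -1 := by
    rw [← ZMod.natCast_mod, hM, Nat.cast_sub hp1.le, ZMod.natCast_self, Nat.cast_one, zero_sub]
  have hpow : ((M ^ (p - 1) : ℕ) : ZMod (p ^ 2)) = 1 := by
    rw [Nat.cast_pow, hMz, (hp.out.even_sub_one hp2).neg_one_pow]
  have := congrArg ZMod.val hpow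
  rwa [ZMod.val_natCast, ZMod.val_one] at this

/-- A natural number prime to `p` has valuation `1` in `ℚ̄_p`. [folklore] -/
theorem v_natCast_eq_one_of_not_dvd {n : ℕ} (hn : ¬ p ∣ n) : Valued.v ((n : ℕ) : PadicAlgCl p) = 1 := by
  rw [← map_natCast (algebraMap ℚ_[p] (PadicAlgCl p)), PadicAlgCl.valuation_def]
  ext
  rw [coe_nnnorm, NNReal.coe_one]
  change ‖((n : ℚ_[p]) : PadicAlgCl p)‖ = 1
  rw [PadicAlgCl.norm_extends, Padic.norm_natCast_eq_one_iff]
  exact (Nat.Prime.coprime_iff_not_dvd hp.out).mpr hn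

/-- `p` has valuation `< 1` in `ℚ̄_p`. [folklore] -/
theorem v_natCast_prime_lt_one : Valued.v ((p : ℕ) : PadicAlgCl p) < 1 := by
  rw [PadicAlgCl.valuation_p, one_div]
  exact inv_lt_one_of_one_lt₀ (by exact_mod_cast hp.out.one_lt)

/-- `M ≡ -1 (mod p²)` gives `v (M + 1) < 1` in `ℚ̄_p`. [folklore] -/
theorem v_natCast_add_one_lt_one {M : ℕ} (hM : M % (p ^ 2) = p ^ 2 - 1) :
    Valued.v ((M : PadicAlgCl p) + 1) < 1 := by
  have hp1 : 1 ≤ p ^ 2 := Nat.one_le_pow _ _ hp.out.pos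
  have hdvd : p ∣ M + 1 := by
    refine (dvd_pow_self p two_ne_zero).trans ?_
    rw [← Nat.div_add_mod M (p ^ 2), hM, add_assoc, Nat.sub_add_cancel hp1]
    exact (dvd_mul_right _ _).add dvd_rfl
  obtain ⟨t, ht⟩ := hdvd
  have h : ((M : PadicAlgCl p) + 1) = ((p : ℕ) : PadicAlgCl p) * ((t : ℕ) : PadicAlgCl p) := by
    exact_mod_cast congrArg (fun n : ℕ => (n : PadicAlgCl p)) ht
  rw [h]
  exact v_mul_lt_one_left v_natCast_prime_lt_one (v_natCast_le_one t)

/-- `v (x ^ n - 1) < 1` for all `n : ℤ` once `v (x - 1) < 1`. [folklore] -/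
theorem v_zpow_sub_one_lt_one {x : PadicAlgCl p} (hx : Valued.v (x - 1) < 1) (n : ℤ) :
    Valued.v (x ^ n - 1) < 1 := by
  have hvx : Valued.v x = 1 := v_eq_one_of_sub_one_lt hx
  have hx0 : x ≠ 0 := fun h => by rw [h, Valuation.map_zero] at hvx; exact zero_ne_one hvx
  have hpow : ∀ i : ℕ, Valued.v (x ^ i - 1) < 1 := by
    intro i
    induction i with
    | zero => simp
    | succ n ih =>
      have : x ^ (n + 1) - 1 = x * (x ^ n - 1) + (x - 1) := by ring
      rw [this]
      refine Valuation.map_add_lt _ ?_ hx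
      rw [map_mul, hvx, one_mul]
      exact ih
  obtain ⟨m, rfl | rfl⟩ := n.eq_nat_or_neg
  · rw [zpow_natCast]; exact hpow m
  · rw [zpow_neg, zpow_natCast]
    have hxm : Valued.v (x ^ m) = 1 := by rw [map_pow, hvx, one_pow]
    have hne : x ^ m ≠ 0 := pow_ne_zero _ hx0
    have : (x ^ m)⁻¹ - 1 = (x ^ m)⁻¹ * (-(x ^ m - 1)) := by field_simp; ring
    rw [this, map_mul, map_inv₀, hxm, inv_one, one_mul, Valuation.map_neg]
    exact hpow m

/-- The unit root of `X² - aX + c` (`v c < 1`, `a ≡ 1`) is `≡ 1`. [folklore] -/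
theorem v_sub_one_lt_one_of_root {a c α : PadicAlgCl p} (hαv : Valued.v α = 1)
    (hroot : α ^ 2 - a * α + c = 0) (hc : Valued.v c < 1) (ha : Valued.v (a - 1) < 1) :
    Valued.v (α - 1) < 1 := by
  have hprod : α * (α - a) = -c := by linear_combination hroot
  have hαa : Valued.v (α - a) < 1 := by
    have := congrArg Valued.v hprod
    rw [map_mul, hαv, one_mul, Valuation.map_neg] at this
    rw [this]; exact hc
  have e : α - 1 = (α - a) + (a - 1) := by ring
  rw [e]
  exact v_add_lt_one hαa ha

/-- A root of unity times a positive power of `p` has valuation `< 1` in `ℚ̄_p`. [folklore] -/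
theorem v_mul_prime_pow_lt_one {x : PadicAlgCl p} {m n : ℕ} (hm : m ≠ 0) (hx : x ^ m = 1) (hn : n ≠ 0) :
    Valued.v (x * ((p : ℕ) : PadicAlgCl p) ^ n) < 1 := by
  have hxv : Valued.v x ≤ 1 := by
    have h2 : Valued.v x ^ m = 1 := by rw [← map_pow, hx, map_one]
    by_contra h
    push Not at h
    exact absurd h2 (one_lt_pow₀ h hm).ne'
  refine v_mul_lt_one_right hxv ?_
  rw [map_pow]
  exact pow_lt_one₀ zero_le v_natCast_prime_lt_one hn

/-- For `p` odd, `v (e + 1) < 1` excludes `v (e - 1) < 1` (`v 2 = 1`). [folklore] -/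
theorem not_v_sub_one_lt_one (hp2 : p ≠ 2) {e : PadicAlgCl p} (he : Valued.v (e + 1) < 1) :
    ¬ Valued.v (e - 1) < 1 := by
  intro h
  have h2 := v_sub_lt_one he h
  have ee : e + 1 - (e - 1) = (2 : ℕ) := by push_cast; ring
  rw [ee, v_natCast_eq_one_of_not_dvd
    (fun hd => hp2 ((Nat.prime_dvd_prime_iff_eq hp.out Nat.prime_two).mp hd))] at h2
  exact lt_irrefl _ h2

/-- **Odd representations**: if `c² = 1` and `det ρ(c) ≡ e` with `e ≡ -1` (`p` odd), then `ρ(c)` is an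
involution of determinant exactly `-1`. [folklore] -/
theorem det_eq_neg_one_of_odd (hp2 : p ≠ 2) {G : Type*} [Group G] [TopologicalSpace G]
    (ρ : FramedRep G (PadicAlgCl p) 2) {c : G} (hc : c ^ 2 = 1) {e : PadicAlgCl p}
    (hdet : Valued.v ((ρ c).val.det - e) < 1) (he : Valued.v (e + 1) < 1) :
    ρ c * ρ c = 1 ∧ (ρ c).val.det = -1 := by
  have hcc : ρ c * ρ c = 1 := by rw [← map_mul, ← pow_two, hc, map_one]
  refine ⟨hcc, ?_⟩
  have hsq : (ρ c).val.det * (ρ c).val.det = 1 := by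
    rw [← Matrix.det_mul, ← Units.val_mul, hcc, Units.val_one, Matrix.det_one]
  rcases mul_self_eq_one_iff.mp hsq with h1 | h1
  · exfalso
    apply not_v_sub_one_lt_one hp2 he
    rw [h1, ← Valuation.map_neg, neg_sub] at hdet
    exact hdet
  · exact h1

end LevelRaisingPrime

/-! ### Registered sub-goal -/

section Alias

/-- **Registered sub-goal of `stub_eisensteinPackageQ` (support file I): the Billerey–Menares weight**
(= `exists_bmWeight`, same text). [folklore] -/
theorem stub_eisensteinPackageQ_auxWeight :
    ∀ (p : ℕ) [Fact p.Prime], p ≠ 2 → ∀ (η : Field.absoluteGaloisGroup ℚ →ₜ* (PadicAlgCl p)ˣ),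
      (∀ τ, Valued.v ((η τ : (PadicAlgCl p)ˣ) : PadicAlgCl p) = 1) →
      ∀ (w : IsDedekindDomain.HeightOneSpectrum (NumberField.RingOfIntegers ℚ)),
      (p : NumberField.RingOfIntegers ℚ) ∈ w.asIdeal →
      ∃ k : ℕ, (k = p ∨ k = p + 1 ∨ (3 ≤ k ∧ k + 1 ≤ p)) ∧
        ∃ 𝔓 ∈ w.primesAbove, ∀ σ ∈ 𝔓.inertia (Field.absoluteGaloisGroup ℚ),
        Valued.v (((η σ : (PadicAlgCl p)ˣ) : PadicAlgCl p) -
          algebraMap (Padic p) (PadicAlgCl p)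
            (((Literature.NumberTheory.GaloisRepresentations.GaloisRep.cyclotomicCharacter ℚ p σ).val :
              PadicInt p) : Padic p) ^ (k - 1)) < 1 :=
  exists_bmWeight

end Alias

end Summit.Langlands.Langlands.Theorems.SkinnerWilesDefectOne.EisensteinProModularSeed
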